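import Literature.Analysis.FluidPDE.MikadoDataStep
import HarnessLib

/-!
# The Coiculescu–Palasek data iteration (Def. 3.5) across all levels, with the uniform
# all-orders upper bounds of Prop. 3.7 / (psidatabounds)

Analysis/FluidPDE support file (definitions with proved API; no named facts) on the discharge path of
the principal-parts hypothesis `hA` of
`Literature.Barriers.NavierStokesRegularity.CriticalDataSmoothNonuniqueness_of_principalParts_of_perturbationLe`
(M. P. Coiculescu, S. Palasek, *Non-uniqueness of smooth solutions of the Navier–Stokes equations from
critical data*, Invent. Math. 244 (2025), arXiv:2503.14699). **Def. 3.5**: "Let `ψ₀⁰ ≔ N₀ φ₀ ∗ Ψ⁰_{1,0}`.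
Given any `ψ⁰_{k-1}` and `k ≥ 1`, we inductively define `ψ⁰_k ≔ φ_k ∗ ∑_j a_{j,k} Ψ⁰_{j,k}` where
`a_{j,k} = N_k (2‖𝒟ψ⁰_{k-1}‖/(c₀|η_j|²A_{j,k}))^{1/2} χ_k Γ_j(Id + c₀𝒟ψ⁰_{k-1}/‖𝒟ψ⁰_{k-1}‖)`"; **Prop. 3.7**:
"`‖∇ᵐψ⁰_k‖_{L^∞} ≲_m N_k^{-1+m}` for all `k, m ≥ 0`" (with the implicit constants independent of `k`
and of the scale parameter `A`, §2.4).

This file runs the one-step map of `MikadoDataStep` along `k ∈ ℕ` for given inputs — profiles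
`φ_j`, phases `Λ_{j,k}`, averages `A_{j,k}`, cut-offs `χ_k`, scales `M_k ≤ N_k`, mollification lengths
`ℓ_k`, and the level-independent constants `CP25.IterConsts` (`G n`, `A₀`, `cχ n`) — bundled in
`CP25.IterData`, together with the sequence of normalisations `D_k` (`CP25.IterConsts.Dseq`:
`D₀ = 480 G₁ + 1`, `D_{k+1} = 8𝔎₁κ₁ √D_k + 1`, the explicit UPPER bounds `D_k ≥ ‖𝒟g_k‖_∞` replacing the
paper's `‖𝒟ψ⁰_k‖_∞`, see `NashCoefficientFields`; a function of the constants alone), and proves: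

* `CP25.IterData.pre k` (`g_k = ∑_j a_{j,k}Ψ⁰_{j,k}`, with `a_{j,0} = N₀ δ_{j,1}`), `potential k`
  (`ψ⁰_k = k_{ℓ_k} ⋆ g_k`), `tensor k` (`k_{ℓ_k} ⋆ 𝒟g_k = 𝒟ψ⁰_k`), `amp k j` (`a_{j,k}`), `pipe k j`
  (`Ψ⁰_{j,k}`), and `pre_succ` / `pre_eq_sum_amp_smul_pipe` (the defining formulas);
* `CP25.IterData.Admissible` — the hypotheses on the inputs under which the estimates hold (profile
  bounds `‖Dⁱφ_j‖ ≤ G_n` for `i ≤ n`, unit phases, `A_{j,k} ≥ A₀ > 0`, cut-off bounds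
  `‖Dⁱχ_{k+1}‖ ≤ (cχ_n M_k)ⁱ`, `M_k ≤ N_k ≤ N_{k+1}`, `0 < ℓ_k ≤ 1/4`, `ℓ_k N_{k+1} ≥ 1`); the frequency
  `CP25.IterData.Λf n k = c̄_n/ℓ_k + cχ_n M_k` feeding level `k+1`;
* `CP25.IterData.Admissible.norm_dTensor_pre_le` — **the induction of Prop. 3.7 (upper bound)**:
  `‖𝒟g_k‖_∞ ≤ D_k` for all `k`, and `D_k ≤ D̄` uniformly (`Dseq_le_Dbar`);
* `CP25.IterData.Admissible.hasLiftDerivBounds_pre` — **(psidatabounds), all orders, uniform in `k`**: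
  `‖Dⁱg_k‖_∞ ≤ (B_n/N_k)(κ_n N_k)ⁱ` for all `i ≤ n`, all `k`, with `B_n`, `κ_n` depending only on `n`
  and the admissibility constants — "`‖∇ᵐψ⁰_k‖_{L^∞} ≲_m N_k^{-1+m}`"; the same for `ψ⁰_k`
  (`hasLiftDerivBounds_potential`) and, one order lower with an extra `N_k`, for `𝒟g_k`, `𝒟ψ⁰_k`
  (`hasLiftDerivBounds_dTensor_pre`, `hasLiftDerivBounds_tensor_true`), plus the mollifier form
  `hasLiftDerivBounds_tensor` (`‖Dⁱ(k_ℓ ⋆ 𝒟g_k)‖ ≤ D_k (c̄_n/ℓ_k)ⁱ`) that feeds the next amplitude.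
The lower bounds of Prop. 3.7 are not needed for Thm. 1.2 beyond level `0` and are not formalised
(see `MikadoDataStep`).

## Mathlib / tree search

Tree: `CP25.stepPre`, `CP25.ampCoeff`, `CP25.pipePotential`, `CP25.hasLiftDerivBounds_stepPre`,
`CP25.hasLiftDerivBounds_dTensor_stepPre`, `CP25.hasLiftDerivBounds_stepTensor_of_norm_le`,
`CP25.hasLiftDerivBounds_pipePotential`, `CP25.hasLiftDerivBounds_dTensor`, `CP25.nashFieldConst`
(`MikadoDataStep`), `Torus.HasLiftDerivBounds` (`TorusLiftDerivBounds`). `lean search 'IterData|Dseq|data iteration'`: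
nothing prior for this paper.

## On the hypothesis `h : I.Admissible`

`CP25.IterData.Admissible I` (the `structure … : Prop` defined in this file) bundles the standing
HYPOTHESES on the abstract inputs `I` (profile bounds, unit phases, positive averages, scale relations,
cut-off bounds); the theorems below take `h : I.Admissible` as a section hypothesis (`variable … include h`).
It is not a named fact and nothing here assumes a conclusion: the predicate is PROVED for the paper's
concrete inputs in `CP25.admissible_mkIter` (`MikadoInputs`), which is how these theorems are used.

## References

* M. P. Coiculescu, S. Palasek, Invent. Math. 244 (2025) 165–219, doi:10.1007/s00222-025-01396-z,
  arXiv:2503.14699: Def. 3.5, Lemma 3.6, Prop. 3.7 ((psidataupperandlowerbounds) upper half,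
  (psidatabounds)), §2.4 (dependence of constants). [CoiculescuPalasek2025]
-/

noncomputable section

open Set Function MeasureTheory Filter UnitAddTorus
open scoped BigOperators ContDiff Convolution Topology

namespace Literature.Analysis.FluidPDE

namespace CP25

open Literature.Analysis.FunctionSpaces Literature.Analysis.FunctionSpaces.Torus

/-! ## The inputs of the iteration -/

/-- **The level-independent constants of the iteration**: the profile derivative bounds `G n`, the
lower bound `A₀` of the phase averages, and the cut-off frequency constants `cχ n`. Every constant of
the bookkeeping below (`𝔎_n`, `κ_n`, `D_k`, `D̄`, `B_n`, and the block constants of the later files) is a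
function of these alone — in particular independent of the scales. [cite: CoiculescuPalasek2025, Prop. 3.7 and Prop. 3.13] -/
structure IterConsts where
  /-- profile derivative bounds by order -/
  G : ℕ → ℝ
  /-- lower bound of the averages -/
  A₀ : ℝ
  /-- cut-off frequency constants by order -/
  cχ : ℕ → ℝ

namespace IterConsts

variable (C : IterConsts)

/-- The amplitude constant `𝔎_n = 3 G_n (2π²c₀A₀)^{-1/2} ∑_j C_Γ(j,n)` of `hasLiftDerivBounds_stepPre`.
[cite: CoiculescuPalasek2025, Lemma 3.6] -/
def K (n : ℕ) : ℝ :=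
  3 * C.G n * Real.sqrt (2 * Real.pi ^ 2 * nashRadius * C.A₀)⁻¹ * ∑ j, nashFieldConst j n

/-- The frequency constant `κ_n = 2(c̄_n + cχ_n) + 20` (`2Λf + 20N ≤ κ_n N` when
`Λf ≤ (c̄_n + cχ_n) N`). [cite: CoiculescuPalasek2025, Prop. 3.7] -/
def κ (n : ℕ) : ℝ := 2 * (derivProfileMassSup (Fin 3) n + C.cχ n) + 20

/-- **The normalisations `D_k`** (explicit upper bounds for `‖𝒟g_k‖_∞`, kept `≥ 1`): `D₀ = 480 G₁ + 1`,
`D_{k+1} = 8 𝔎₁ κ₁ √D_k + 1`. This is the recursion `‖𝒟ψ⁰_k‖ ≤ C₂ ‖𝒟ψ⁰_{k-1}‖^{1/2}` of Prop. 3.7, run as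
a definition (the `+1` keeps the normalisation positive, which is all Def. 3.5 needs of it).
[cite: CoiculescuPalasek2025, Prop. 3.7 (psidataupperandlowerbounds), upper bound] -/
def Dseq : ℕ → ℝ
  | 0 => 480 * C.G 1 + 1
  | k + 1 => 8 * C.K 1 * C.κ 1 * Real.sqrt (Dseq k) + 1

/-- The uniform bound `D̄ = max D₀ (8𝔎₁κ₁ + 1)²` of the normalisations. [cite: CoiculescuPalasek2025, Prop. 3.7] -/
def Dbar : ℝ := max (C.Dseq 0) ((8 * C.K 1 * C.κ 1 + 1) ^ 2)

/-- The uniform amplitude constant `B_n = max (3 G_n) (𝔎_n √D̄)` of (psidatabounds).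
[cite: CoiculescuPalasek2025, Prop. 3.7 (psidatabounds)] -/
def B (n : ℕ) : ℝ := max (3 * C.G n) (C.K n * Real.sqrt C.Dbar)

end IterConsts

/-- **The inputs of the data iteration** (Def. 3.5 with Def. 3.1, Lemma 3.2 (4), Def. 3.4, §2.4):
the six pipe profiles `φ_j`, the unit phases `Λ_{j,k}`, the phase averages `A_{j,k}`, the cut-offs
`χ_k`, the scales `M_k`, `N_k`, the mollification lengths `ℓ_k`; and the three families of constants
entering the normalisations `D_k` — `G n` (profile derivative bounds), `A₀` (lower bound of the
averages), `cχ n` (cut-off frequency constants). [cite: CoiculescuPalasek2025, Def. 3.5 and §2.4] -/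
structure IterData where
  /-- the pipe profiles `φ̃_j` -/
  φ : Fin 6 → UnitAddTorus (Fin 3) → ℝ
  /-- the unit phases `Λ_{j,k}` of the potentials at level `k` -/
  Λ : ℕ → Fin 6 → ℂ
  /-- the phase averages `A_{j,k}` -/
  A : ℕ → Fin 6 → ℝ
  /-- the cut-offs `χ_k` (only `k ≥ 1` is used) -/
  χ : ℕ → UnitAddTorus (Fin 3) → ℝ
  /-- the profile scales `M_k` -/
  M : ℕ → ℕ
  /-- the oscillation scales `N_k` -/
  N : ℕ → ℕ
  /-- the mollification lengths `ℓ_k` -/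
  ℓ : ℕ → ℝ
  /-- the level-independent constants `G n`, `A₀`, `cχ n` -/
  cst : IterConsts
  /-- the exponent `σ` with `ℓ_k⁻¹, M_k ≤ N_{k+1}^σ` (`σ = 1/3 + 2/(3b)` for the scales of §2.4 with `γ = 2`) -/
  σ : ℝ
  /-- the lacunarity ratio `ρ` with `ρ N_k ≤ N_{k+1}` (`N_{k+1}/N_k ≥ A^{γ(b-1)}`, proof of Prop. 3.13) -/
  ρ : ℝ

namespace IterData

variable (I : IterData)

/-- **The frequency feeding level `k+1`**: `Λf_n(k) = c̄_n/ℓ_k + cχ_n M_k` — the derivative cost of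
`k_{ℓ_k} ⋆ 𝒟g_k` (derivatives on the mollifier) plus that of `χ_{k+1}` (`≲ M_k`); `≤ (c̄_n + cχ_n) N_{k+1}`.
[cite: CoiculescuPalasek2025, Lemma 3.6 (gradapreliminarybound) and Prop. 3.7 (proof)] -/
def Λf (n k : ℕ) : ℝ := derivProfileMassSup (Fin 3) n * (I.ℓ k)⁻¹ + I.cst.cχ n * I.M k

/-- **The pre-mollified potentials `g_k`** by recursion on the level: `g₀ = N₀ Ψ⁰_{1,0}` and
`g_{k+1} = ∑_j a_{j,k+1} Ψ⁰_{j,k+1}` with the amplitudes built from `k_{ℓ_k} ⋆ 𝒟g_k` normalised by `D_k`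
(Def. 3.5; `ψ⁰_k = k_{ℓ_k} ⋆ g_k`). [cite: CoiculescuPalasek2025, Def. 3.5] -/
def pre : ℕ → UnitAddTorus (Fin 3) → EuclideanSpace ℝ (Fin 3)
  | 0 => fun x => (I.N 0 : ℝ) • pipePotential 0 (I.φ 0) (I.Λ 0 0) (I.M 0) (I.N 0) x
  | k + 1 => stepPre I.φ (I.Λ (k + 1)) (kernel (I.ℓ k) ⋆ dTensor (pre k)) (I.cst.Dseq k) (I.χ (k + 1))
      (I.A (k + 1)) (I.M (k + 1)) (I.N (k + 1))

/-- **The tensors `k_{ℓ_k} ⋆ 𝒟g_k = 𝒟ψ⁰_k`** entering the next amplitudes. [cite: CoiculescuPalasek2025, Def. 3.5] -/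
def tensor (k : ℕ) : UnitAddTorus (Fin 3) → (Fin 3 → Fin 3 → ℝ) := kernel (I.ℓ k) ⋆ dTensor (I.pre k)

/-- **The potentials `ψ⁰_k = k_{ℓ_k} ⋆ g_k`** of Def. 3.5. [cite: CoiculescuPalasek2025, Def. 3.5] -/
def potential (k : ℕ) : UnitAddTorus (Fin 3) → EuclideanSpace ℝ (Fin 3) := kernel (I.ℓ k) ⋆ I.pre k

/-- **The amplitudes `a_{j,k}`**: `a_{j,0} = N₀ δ_{j,1}` ("when `k = 0` … `a_{j,0} = N₀` when `j = 1` and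
`0` otherwise") and `a_{j,k+1}` from the step. [cite: CoiculescuPalasek2025, Def. 3.5] -/
def amp : ℕ → Fin 6 → UnitAddTorus (Fin 3) → ℝ
  | 0 => fun j _ => if j = 0 then (I.N 0 : ℝ) else 0
  | k + 1 => fun j => ampCoeff j (I.tensor k) (I.cst.Dseq k) (I.χ (k + 1)) (I.A (k + 1) j) (I.N (k + 1))

/-- **The pipe potentials `Ψ⁰_{j,k}`** at level `k`. [cite: CoiculescuPalasek2025, Def. 3.1] -/
def pipe (k : ℕ) (j : Fin 6) : UnitAddTorus (Fin 3) → EuclideanSpace ℝ (Fin 3) :=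
  pipePotential j (I.φ j) (I.Λ k j) (I.M k) (I.N k)

/-- The successor formula: `g_{k+1} = stepPre … (tensor k) (D_k) …`. [cite: CoiculescuPalasek2025, Def. 3.5] -/
theorem pre_succ (k : ℕ) :
    I.pre (k + 1) = stepPre I.φ (I.Λ (k + 1)) (I.tensor k) (I.cst.Dseq k) (I.χ (k + 1)) (I.A (k + 1))
      (I.M (k + 1)) (I.N (k + 1)) := rfl

/-- **`g_k = ∑_j a_{j,k} Ψ⁰_{j,k}` at every level** (including `k = 0`). [cite: CoiculescuPalasek2025, Def. 3.5] -/
theorem pre_eq_sum_amp_smul_pipe (k : ℕ) : I.pre k = fun x => ∑ j, I.amp k j x • I.pipe k j x := by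
  cases k with
  | zero =>
    funext x
    simp only [pre, amp, pipe, ite_smul, zero_smul, Finset.sum_ite_eq', Finset.mem_univ, if_true]
  | succ k => rfl

/-! ## Admissible inputs -/

/-- **Admissibility of the inputs** (the standing hypotheses of §3 on the fixed objects): for every
order `n`, the profiles obey `HasLiftDerivBounds n φ_j (G n) 1`; the phases are unit, `‖Λ_{j,k}‖ ≤ 1`;
the averages `A_{j,k} ≥ A₀ > 0` (Lemma 3.2 (4)); the cut-offs obey `HasLiftDerivBounds n χ_{k+1} 1 (cχ_n M_k)`
(Def. 3.4: `‖∇ᵐχ_{k+1}‖ ≲_m M_k^m`, `|χ_{k+1}| ≤ 1`), `0 ≤ cχ_n`; the scales satisfy `M_k ≤ N_k ≤ N_{k+1}`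
(through `M_k ≤ N_{k+1}`), `1 ≤ N_k`; the mollification lengths `0 < ℓ_k ≤ 1/4` with `1 ≤ ℓ_k N_{k+1}` (§2.4:
`ℓ_k = N_{k+1}^{-1/3}N_k^{-2/3} ≥ N_{k+1}^{-1}`); the averages `A_{j,k} ≤ 1`; and the sharper scale separation
`ℓ_k⁻¹, M_k ≤ N_{k+1}^σ` with `0 ≤ σ ≤ 1/2` (for `γ = 2`: `ℓ_k⁻¹ = N_{k+1}^{1/3+2/(3b)}`, `M_k = N_{k+1}^{1/(2b)}`), which
is what makes the inverse-cascade blocks obey `‖∇ᵐv̄_k‖ ≲ N_{k+1}^{1+m}` despite the Hölder loss; and the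
lacunarity `ρ N_k ≤ N_{k+1}` with `ρ ≥ 2` (proof of Prop. 3.13: "`N_{k+1}/N_k = A^{γ(b^{k+1}-b^k)} ≥ A^{γ(b-1)}`").
[cite: CoiculescuPalasek2025, §2.4, Def. 3.1, Lemma 3.2, Def. 3.4, Prop. 3.13] -/
structure Admissible : Prop where
  profile : ∀ n j, HasLiftDerivBounds n (I.φ j) (I.cst.G n) 1
  phase : ∀ k j, ‖I.Λ k j‖ ≤ 1
  A₀_pos : 0 < I.cst.A₀
  average : ∀ k j, I.cst.A₀ ≤ I.A k j
  cutoff : ∀ n k, HasLiftDerivBounds n (I.χ (k + 1)) 1 (I.cst.cχ n * I.M k)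
  cχ_nonneg : ∀ n, 0 ≤ I.cst.cχ n
  M_le_N : ∀ k, I.M k ≤ I.N k
  M_le_N_succ : ∀ k, I.M k ≤ I.N (k + 1)
  one_le_N : ∀ k, 1 ≤ I.N k
  ℓ_pos : ∀ k, 0 < I.ℓ k
  ℓ_le : ∀ k, I.ℓ k ≤ 1 / 4
  ℓ_N : ∀ k, 1 ≤ I.ℓ k * I.N (k + 1)
  A_le_one : ∀ k j, I.A k j ≤ 1
  σ_nonneg : 0 ≤ I.σ
  σ_le_half : I.σ ≤ 1 / 2
  inv_ℓ_le_rpow : ∀ k, (I.ℓ k)⁻¹ ≤ (I.N (k + 1) : ℝ) ^ I.σ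
  M_le_rpow : ∀ k, (I.M k : ℝ) ≤ (I.N (k + 1) : ℝ) ^ I.σ
  two_le_ρ : 2 ≤ I.ρ
  ρ_lacunary : ∀ k, I.ρ * I.N k ≤ I.N (k + 1)

namespace Admissible

variable {I} (h : I.Admissible)
include h

/-- `0 < N_k`. [folklore] -/
theorem N_pos (k : ℕ) : 0 < I.N k := h.one_le_N k

/-- `0 < N_k` in `ℝ`. [folklore] -/
theorem N_pos' (k : ℕ) : (0 : ℝ) < I.N k := by exact_mod_cast h.N_pos k

/-- `0 ≤ G_n`. [folklore] -/
theorem G_nonneg (n : ℕ) : 0 ≤ I.cst.G n := (h.profile n 0).nonneg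

/-- `2 N_k ≤ N_{k+1}` (in `ℝ`). [cite: CoiculescuPalasek2025, Prop. 3.13 (proof)] -/
theorem two_mul_N_le (k : ℕ) : 2 * (I.N k : ℝ) ≤ I.N (k + 1) :=
  le_trans (mul_le_mul_of_nonneg_right h.two_le_ρ (Nat.cast_nonneg _)) (h.ρ_lacunary k)

/-- `N_k ≤ N_{k+1}` (in `ℝ`). [folklore] -/
theorem N_le_succ (k : ℕ) : (I.N k : ℝ) ≤ I.N (k + 1) := by
  have := h.two_mul_N_le k; have := (Nat.cast_nonneg (I.N k) : (0:ℝ) ≤ I.N k); linarith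

/-- `0 ≤ 𝔎_n`. [folklore] -/
theorem K_nonneg (n : ℕ) : 0 ≤ I.cst.K n := by
  have := h.G_nonneg n
  have : 0 ≤ ∑ j, nashFieldConst j n :=
    Finset.sum_nonneg fun j _ => zero_le_one.trans (one_le_nashFieldConst j n)
  unfold IterConsts.K; positivity

/-- `20 ≤ κ_n`. [folklore] -/
theorem twenty_le_κ (n : ℕ) : 20 ≤ I.cst.κ n := by
  have h1 := one_le_derivProfileMassSup (d := Fin 3) n
  have h2 := h.cχ_nonneg n
  unfold IterConsts.κ; linarith

/-- `0 < κ_n`. [folklore] -/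
theorem κ_pos (n : ℕ) : 0 < I.cst.κ n := lt_of_lt_of_le (by norm_num) (h.twenty_le_κ n)

/-- `1 ≤ D_k` (by construction), given `0 ≤ G₁`. [folklore] -/
theorem one_le_Dseq : ∀ k, 1 ≤ I.cst.Dseq k
  | 0 => by have := h.G_nonneg 1; simp only [IterConsts.Dseq]; linarith [mul_nonneg (by norm_num : (0:ℝ) ≤ 480) this]
  | k + 1 => by
    have := h.K_nonneg 1; have := (h.κ_pos 1).le
    have : 0 ≤ 8 * I.cst.K 1 * I.cst.κ 1 * Real.sqrt (I.cst.Dseq k) := by positivity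
    simp only [IterConsts.Dseq]; linarith

/-- `0 < D_k`. [folklore] -/
theorem Dseq_pos (k : ℕ) : 0 < I.cst.Dseq k := lt_of_lt_of_le one_pos (h.one_le_Dseq k)

/-- `1/ℓ_k ≤ N_{k+1}`. [cite: CoiculescuPalasek2025, §2.4] -/
theorem inv_ℓ_le (k : ℕ) : (I.ℓ k)⁻¹ ≤ I.N (k + 1) := by
  rw [inv_le_iff_one_le_mul₀ (h.ℓ_pos k)]
  simpa [mul_comm] using h.ℓ_N k

omit h in
/-- The frequency bookkeeping: with `Λf = (c̄_n + cχ_n) N`, `2Λf + 20N = κ_n N`. [folklore] -/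
theorem two_mul_add_eq (n k : ℕ) :
    2 * ((derivProfileMassSup (Fin 3) n + I.cst.cχ n) * I.N k) + 20 * I.N k = I.cst.κ n * I.N k := by
  unfold IterConsts.κ; ring

/-- `0 ≤ Λf_n(k)`. [folklore] -/
theorem Λf_nonneg (n k : ℕ) : 0 ≤ I.Λf n k := by
  have := one_le_derivProfileMassSup (d := Fin 3) n; have := h.cχ_nonneg n; have := h.ℓ_pos k
  unfold Λf; positivity

/-- `Λf_n(k) ≤ (c̄_n + cχ_n) N_{k+1}` (`1/ℓ_k ≤ N_{k+1}`, `M_k ≤ N_{k+1}`). [folklore] -/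
theorem Λf_le (n k : ℕ) : I.Λf n k ≤ (derivProfileMassSup (Fin 3) n + I.cst.cχ n) * I.N (k + 1) := by
  have hc := one_le_derivProfileMassSup (d := Fin 3) n
  have hχ := h.cχ_nonneg n
  have hM : (I.M k : ℝ) ≤ I.N (k + 1) := by exact_mod_cast h.M_le_N_succ k
  have hℓ := h.inv_ℓ_le k
  unfold Λf
  rw [add_mul]
  exact add_le_add (mul_le_mul_of_nonneg_left hℓ (by positivity)) (mul_le_mul_of_nonneg_left hM hχ)

/-- `Λf_n(k) ≤ (c̄_n + cχ_n) N_{k+1}^σ`. [cite: CoiculescuPalasek2025, §2.4] -/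
theorem Λf_le_rpow (n k : ℕ) : I.Λf n k ≤ (derivProfileMassSup (Fin 3) n + I.cst.cχ n) * (I.N (k + 1) : ℝ) ^ I.σ := by
  have hc := one_le_derivProfileMassSup (d := Fin 3) n
  have hχ := h.cχ_nonneg n
  unfold Λf
  rw [add_mul]
  exact add_le_add (mul_le_mul_of_nonneg_left (h.inv_ℓ_le_rpow k) (by positivity))
    (mul_le_mul_of_nonneg_left (h.M_le_rpow k) hχ)

/-- `4 ≤ Λf_n(k)` (`ℓ_k ≤ 1/4`, `c̄_n ≥ 1`); in particular `1 ≤ Λf_n(k)`. [folklore] -/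
theorem four_le_Λf (n k : ℕ) : 4 ≤ I.Λf n k := by
  have hc := one_le_derivProfileMassSup (d := Fin 3) n
  have hχ := h.cχ_nonneg n
  have hℓ : 4 ≤ (I.ℓ k)⁻¹ := by
    rw [le_inv_comm₀ (by norm_num) (h.ℓ_pos k)]
    have h4 : (4 : ℝ)⁻¹ = 1 / 4 := by norm_num
    rw [h4]; exact h.ℓ_le k
  unfold Λf
  have : 0 ≤ I.cst.cχ n * (I.M k : ℝ) := by positivity
  nlinarith

/-- `2Λf_n(k) + 20N_{k+1} ≤ κ_n N_{k+1}`. [folklore] -/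
theorem two_mul_Λf_add_le (n k : ℕ) : 2 * I.Λf n k + 20 * I.N (k + 1) ≤ I.cst.κ n * I.N (k + 1) := by
  have := h.Λf_le n k
  unfold IterConsts.κ; nlinarith

/-- The cut-off at level `k+1` in the frequency `Λf_n(k)`. [cite: CoiculescuPalasek2025, Def. 3.4] -/
theorem cutoff' (n k : ℕ) : HasLiftDerivBounds n (I.χ (k + 1)) 1 (I.Λf n k) := by
  refine (h.cutoff n k).mono le_rfl (by have := h.cχ_nonneg n; positivity) ?_
  have := one_le_derivProfileMassSup (d := Fin 3) n; have := h.ℓ_pos k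
  unfold Λf
  have : 0 ≤ derivProfileMassSup (Fin 3) n * (I.ℓ k)⁻¹ := by positivity
  linarith

/-! ## The induction of Prop. 3.7 (upper bound) -/

/-- **Level `0`**: `g₀ = N₀ Ψ⁰_{1,0}` obeys `HasLiftDerivBounds n g₀ (3G_n/N₀) (20N₀)`
(Lemma 3.2 (1) times `N₀`). [cite: CoiculescuPalasek2025, Def. 3.5 (k = 0), Lemma 3.2 (1)] -/
theorem hasLiftDerivBounds_pre_zero (n : ℕ) :
    HasLiftDerivBounds n (I.pre 0) (3 * I.cst.G n * ((I.N 0 : ℝ))⁻¹) (20 * I.N 0) := by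
  have hΨ := hasLiftDerivBounds_pipePotential (n := n) 0 (h.profile n 0) (h.phase 0 0) (h.M_le_N 0)
  have h1 := hΨ.const_smul (I.N 0 : ℝ)
  rw [abs_of_nonneg (Nat.cast_nonneg _)] at h1
  refine ⟨h1.isSmooth, fun i hi y => (h1.bound hi y).trans (le_of_eq ?_)⟩
  have hN := (h.N_pos' 0).ne'
  show (I.N 0 : ℝ) * (3 * I.cst.G n * ((I.N 0 : ℝ) ^ 2)⁻¹) * (20 * I.N 0) ^ i =
    3 * I.cst.G n * ((I.N 0 : ℝ))⁻¹ * (20 * I.N 0) ^ i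
  field_simp

/-- **Level `0`, the tensor**: `‖𝒟g₀‖_∞ ≤ 480 G₁ ≤ D₀`. [cite: CoiculescuPalasek2025, Prop. 3.7 (k = 0)] -/
theorem norm_dTensor_pre_zero_le (x : UnitAddTorus (Fin 3)) : ‖dTensor (I.pre 0) x‖ ≤ I.cst.Dseq 0 := by
  have h0 := h.hasLiftDerivBounds_pre_zero 1
  have hD := hasLiftDerivBounds_dTensor h0 (by have := h.N_pos' 0; positivity)
  refine (hD.norm_le x).trans ?_
  have hN := (h.N_pos' 0).ne'
  have heq : 8 * (3 * I.cst.G 1 * ((I.N 0 : ℝ))⁻¹ * (20 * I.N 0)) = 480 * I.cst.G 1 := by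
    field_simp; ring
  rw [heq]
  simp only [IterConsts.Dseq]
  linarith

/-- **The tensor `k_{ℓ_k} ⋆ 𝒟g_k` from the sup bound** (all orders on the mollifier): if `g_k` is smooth
with `‖𝒟g_k‖_∞ ≤ D_k` then `‖k_ℓ ⋆ 𝒟g_k‖ ≤ D_k` and `HasLiftDerivBounds n (k_ℓ ⋆ 𝒟g_k) (D_k/c₀) (Λf_n(k))`
for every `n`. [cite: CoiculescuPalasek2025, Prop. 3.7 (proof: derivatives on the mollifier)] -/
theorem tensor_bounds_of {k : ℕ} (hsm : IsSmooth (I.pre k)) (hD : ∀ x, ‖dTensor (I.pre k) x‖ ≤ I.cst.Dseq k)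
    (n : ℕ) :
    (∀ x, ‖I.tensor k x‖ ≤ I.cst.Dseq k) ∧ HasLiftDerivBounds n (I.tensor k) (I.cst.Dseq k / nashRadius) (I.Λf n k) := by
  refine ⟨fun x => norm_kernel_convolution_le (h.ℓ_pos k) (h.ℓ_le k) hD x, ?_⟩
  have h1 : HasLiftDerivBounds n (I.tensor k) (I.cst.Dseq k) (derivProfileMassSup (Fin 3) n / I.ℓ k) :=
    hasLiftDerivBounds_kernel_convolution_of_norm_le
      (contDiff_pi.2 fun a => contDiff_pi.2 fun b => isSmooth_dTensor_entry hsm a b) hD (h.ℓ_pos k) (h.ℓ_le k) n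
  refine h1.mono ?_ (by have := h.ℓ_pos k; have := one_le_derivProfileMassSup (d := Fin 3) n; positivity) ?_
  · -- `D_k ≤ D_k / c₀`
    rw [le_div_iff₀ nashRadius_pos]
    have := (h.Dseq_pos k).le
    nlinarith [show nashRadius ≤ 1 by norm_num [nashRadius]]
  · -- `c̄_n/ℓ_k ≤ Λf_n(k)`
    rw [div_eq_mul_inv]
    have := h.cχ_nonneg n
    unfold Λf
    have : 0 ≤ I.cst.cχ n * (I.M k : ℝ) := by positivity
    linarith

/-- **The step at level `k+1`, all orders**: if `g_k` is smooth with `‖𝒟g_k‖_∞ ≤ D_k` then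
`HasLiftDerivBounds n g_{k+1} (𝔎_n √D_k N_{k+1}⁻¹) (κ_n N_{k+1})` ((psidatabounds) at level `k+1`).
[cite: CoiculescuPalasek2025, Lemma 3.6 and Prop. 3.7 (psidatabounds)] -/
theorem hasLiftDerivBounds_pre_succ_of {k : ℕ} (hsm : IsSmooth (I.pre k))
    (hD : ∀ x, ‖dTensor (I.pre k) x‖ ≤ I.cst.Dseq k) (n : ℕ) :
    HasLiftDerivBounds n (I.pre (k + 1)) (I.cst.K n * Real.sqrt (I.cst.Dseq k) * ((I.N (k + 1) : ℝ))⁻¹)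
      (I.cst.κ n * I.N (k + 1)) := by
  obtain ⟨hTb, hT⟩ := h.tensor_bounds_of hsm hD n
  have hs := hasLiftDerivBounds_stepPre (n := n) (φ := I.φ) (Λc := I.Λ (k + 1)) (A := I.A (k + 1))
    (M := I.M (k + 1)) (N := I.N (k + 1)) (h.Dseq_pos k) hTb hT (h.cutoff' n k) (h.Λf_nonneg n k)
    (fun j => h.profile n j) (fun j => h.phase (k + 1) j) h.A₀_pos (fun j => h.average (k + 1) j)
    (h.M_le_N (k + 1)) (h.N_pos (k + 1))
  exact hs.mono le_rfl (by have := h.Λf_nonneg n k; have := (h.N_pos' (k + 1)).le; positivity)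
    (h.two_mul_Λf_add_le n k)

/-- **The inductive core of Prop. 3.7 (upper bound)**: for every level `k`, `g_k` is smooth and
`‖𝒟g_k‖_∞ ≤ D_k`. Step: `‖𝒟g_{k+1}‖ ≤ 8 (𝔎₁√D_k/N_{k+1}) (κ₁N_{k+1}) = 8𝔎₁κ₁√D_k ≤ D_{k+1}`.
[cite: CoiculescuPalasek2025, Lemma 3.6 (iterativeboundsII) and Prop. 3.7 (proof, upper bound)] -/
theorem smooth_and_norm_dTensor_pre_le : ∀ k, IsSmooth (I.pre k) ∧ ∀ x, ‖dTensor (I.pre k) x‖ ≤ I.cst.Dseq k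
  | 0 => ⟨(h.hasLiftDerivBounds_pre_zero 0).isSmooth, h.norm_dTensor_pre_zero_le⟩
  | k + 1 => by
    obtain ⟨hsm, hD⟩ := smooth_and_norm_dTensor_pre_le k
    have h1 := h.hasLiftDerivBounds_pre_succ_of hsm hD 1
    have hDT := hasLiftDerivBounds_dTensor h1 (by have := (h.κ_pos 1).le; have := (h.N_pos' (k + 1)).le; positivity)
    refine ⟨h1.isSmooth, fun x => (hDT.norm_le x).trans ?_⟩
    have hN := (h.N_pos' (k + 1)).ne'
    have heq : 8 * (I.cst.K 1 * Real.sqrt (I.cst.Dseq k) * ((I.N (k + 1) : ℝ))⁻¹ * (I.cst.κ 1 * I.N (k + 1))) =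
        8 * I.cst.K 1 * I.cst.κ 1 * Real.sqrt (I.cst.Dseq k) := by
      field_simp
    rw [heq]
    show 8 * I.cst.K 1 * I.cst.κ 1 * Real.sqrt (I.cst.Dseq k) ≤ I.cst.Dseq (k + 1)
    simp only [IterConsts.Dseq]
    linarith

/-- `g_k` is smooth. [cite: CoiculescuPalasek2025, Lemma 3.2 (1), Def. 3.5] -/
theorem isSmooth_pre (k : ℕ) : IsSmooth (I.pre k) := (h.smooth_and_norm_dTensor_pre_le k).1

/-- **Prop. 3.7, upper bound**: `‖𝒟g_k‖_∞ ≤ D_k` (hence `‖𝒟ψ⁰_k‖_∞ ≤ D_k`).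
[cite: CoiculescuPalasek2025, Prop. 3.7 (psidataupperandlowerbounds), upper bound] -/
theorem norm_dTensor_pre_le (k : ℕ) (x : UnitAddTorus (Fin 3)) : ‖dTensor (I.pre k) x‖ ≤ I.cst.Dseq k :=
  (h.smooth_and_norm_dTensor_pre_le k).2 x

/-- `‖k_{ℓ_k} ⋆ 𝒟g_k‖ ≤ D_k`. [cite: CoiculescuPalasek2025, Prop. 3.7] -/
theorem norm_tensor_le (k : ℕ) (x : UnitAddTorus (Fin 3)) : ‖I.tensor k x‖ ≤ I.cst.Dseq k :=
  (h.tensor_bounds_of (h.isSmooth_pre k) (h.norm_dTensor_pre_le k) 0).1 x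

/-- **The tensor feeding level `k+1`, all orders on the mollifier**:
`HasLiftDerivBounds n (k_{ℓ_k} ⋆ 𝒟g_k) (D_k/c₀) (Λf_n(k))`.
[cite: CoiculescuPalasek2025, Prop. 3.7 (proof)] -/
theorem hasLiftDerivBounds_tensor (n k : ℕ) :
    HasLiftDerivBounds n (I.tensor k) (I.cst.Dseq k / nashRadius) (I.Λf n k) :=
  (h.tensor_bounds_of (h.isSmooth_pre k) (h.norm_dTensor_pre_le k) n).2

/-! ## Uniformity in the level -/

/-- **`D_k ≤ D̄` for all `k`** (the recursion `D_{k+1} = 8𝔎₁κ₁√D_k + 1` stays below the larger of `D₀`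
and its fixed-point scale `(8𝔎₁κ₁+1)²`). This is "the first term stays bounded as `k → ∞`" /
"`(C₂²‖𝒟ψ₀⁰‖)^{2^{-k}}` bounded" of Prop. 3.7. [cite: CoiculescuPalasek2025, Prop. 3.7] -/
theorem Dseq_le_Dbar : ∀ k, I.cst.Dseq k ≤ I.cst.Dbar
  | 0 => le_max_left _ _
  | k + 1 => by
    have ih := Dseq_le_Dbar k
    set c : ℝ := 8 * I.cst.K 1 * I.cst.κ 1 with hc
    have hc0 : 0 ≤ c := by have := h.K_nonneg 1; have := (h.κ_pos 1).le; positivity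
    have hB1 : (c + 1) ^ 2 ≤ I.cst.Dbar := le_max_right _ _
    have hB0 : 0 ≤ I.cst.Dbar := le_trans (h.Dseq_pos 0).le (le_max_left _ _)
    -- `√D_k ≤ √D̄` and `c √D̄ + 1 ≤ (c+1) √D̄ ≤ D̄` since `√D̄ ≥ c + 1 ≥ 1`
    have hsq : c + 1 ≤ Real.sqrt I.cst.Dbar := by
      rw [show c + 1 = Real.sqrt ((c + 1) ^ 2) by rw [Real.sqrt_sq (by linarith)]]
      exact Real.sqrt_le_sqrt hB1
    have h1 : Real.sqrt (I.cst.Dseq k) ≤ Real.sqrt I.cst.Dbar := Real.sqrt_le_sqrt ih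
    show c * Real.sqrt (I.cst.Dseq k) + 1 ≤ I.cst.Dbar
    calc c * Real.sqrt (I.cst.Dseq k) + 1 ≤ c * Real.sqrt I.cst.Dbar + 1 * Real.sqrt I.cst.Dbar := by
          have : 1 ≤ Real.sqrt I.cst.Dbar := by linarith
          nlinarith [mul_le_mul_of_nonneg_left h1 hc0]
      _ = (c + 1) * Real.sqrt I.cst.Dbar := by ring
      _ ≤ Real.sqrt I.cst.Dbar * Real.sqrt I.cst.Dbar :=
          mul_le_mul_of_nonneg_right hsq (Real.sqrt_nonneg _)
      _ = I.cst.Dbar := Real.mul_self_sqrt hB0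

/-- `1 ≤ D̄`. [folklore] -/
theorem one_le_Dbar : 1 ≤ I.cst.Dbar := (h.one_le_Dseq 0).trans (le_max_left _ _)

/-- **(psidatabounds) of Prop. 3.7, all orders, uniform in the level**: for every `n` and every level `k`,
`HasLiftDerivBounds n g_k (B_n/N_k) (κ_n N_k)`, i.e. `‖Dⁱg_k‖_∞ ≤ B_n κ_nⁱ N_k^{i-1}` for `i ≤ n`, with
`B_n`, `κ_n` independent of `k` (and of the scales) — "`‖∇ᵐψ⁰_k‖_{L^∞} ≲_m N_k^{-1+m}`".
[cite: CoiculescuPalasek2025, Prop. 3.7 (psidatabounds)] -/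
theorem hasLiftDerivBounds_pre (n : ℕ) : ∀ k, HasLiftDerivBounds n (I.pre k) (I.cst.B n * ((I.N k : ℝ))⁻¹) (I.cst.κ n * I.N k)
  | 0 => by
    refine (h.hasLiftDerivBounds_pre_zero n).mono ?_ (by have := (h.N_pos' 0).le; positivity) ?_
    · exact mul_le_mul_of_nonneg_right (le_max_left _ _) (by have := h.N_pos' 0; positivity)
    · exact mul_le_mul_of_nonneg_right (h.twenty_le_κ n) (h.N_pos' 0).le
  | k + 1 => by
    refine (h.hasLiftDerivBounds_pre_succ_of (h.isSmooth_pre k) (h.norm_dTensor_pre_le k) n).mono ?_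
      (by have := (h.κ_pos n).le; have := (h.N_pos' (k + 1)).le; positivity) le_rfl
    refine mul_le_mul_of_nonneg_right ?_ (by have := h.N_pos' (k + 1); positivity)
    exact (mul_le_mul_of_nonneg_left (Real.sqrt_le_sqrt (h.Dseq_le_Dbar k)) (h.K_nonneg n)).trans (le_max_right _ _)

/-- **The potentials `ψ⁰_k = k_{ℓ_k} ⋆ g_k` obey the same bounds** (the mollifier does not increase
`‖Dⁱ·‖_∞`). [cite: CoiculescuPalasek2025, Prop. 3.7 (psidatabounds)] -/
theorem hasLiftDerivBounds_potential (n k : ℕ) :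
    HasLiftDerivBounds n (I.potential k) (I.cst.B n * ((I.N k : ℝ))⁻¹) (I.cst.κ n * I.N k) :=
  (h.hasLiftDerivBounds_pre n k).kernel_convolution (h.ℓ_pos k) (h.ℓ_le k)

/-- **`𝒟g_k` with its true frequency**: `HasLiftDerivBounds n (𝒟g_k) (8 B_{n+1} κ_{n+1}) (κ_{n+1} N_k)` —
"`‖∇ᵐ𝒟ψ⁰_k‖ ≲ N_k^m`" with all derivatives on the oscillation. [cite: CoiculescuPalasek2025, Prop. 3.7] -/
theorem hasLiftDerivBounds_dTensor_pre (n k : ℕ) :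
    HasLiftDerivBounds n (dTensor (I.pre k)) (8 * (I.cst.B (n + 1) * I.cst.κ (n + 1))) (I.cst.κ (n + 1) * I.N k) := by
  have h1 := hasLiftDerivBounds_dTensor (h.hasLiftDerivBounds_pre (n + 1) k)
    (by have := (h.κ_pos (n + 1)).le; have := (h.N_pos' k).le; positivity)
  refine ⟨h1.isSmooth, fun i hi y => (h1.bound hi y).trans (le_of_eq ?_)⟩
  have hN := (h.N_pos' k).ne'
  field_simp

/-- The same for `𝒟ψ⁰_k = k_{ℓ_k} ⋆ 𝒟g_k`. [cite: CoiculescuPalasek2025, Prop. 3.7] -/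
theorem hasLiftDerivBounds_tensor_true (n k : ℕ) :
    HasLiftDerivBounds n (I.tensor k) (8 * (I.cst.B (n + 1) * I.cst.κ (n + 1))) (I.cst.κ (n + 1) * I.N k) :=
  (h.hasLiftDerivBounds_dTensor_pre n k).kernel_convolution (h.ℓ_pos k) (h.ℓ_le k)

/-- `𝒟ψ⁰_k = 𝒟(k_{ℓ_k} ⋆ g_k) = k_{ℓ_k} ⋆ 𝒟g_k`: the tensor is `𝒟` of the potential.
[cite: CoiculescuPalasek2025, Def. 3.5] -/
theorem tensor_eq_dTensor_potential (k : ℕ) : I.tensor k = dTensor (I.potential k) := by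
  rw [tensor, potential, dTensor_kernel_convolution (h.isSmooth_pre k) (h.ℓ_pos k) (h.ℓ_le k)]

/-- The tensor is symmetric. [cite: CoiculescuPalasek2025, Def. 3.4] -/
theorem tensor_symm (k : ℕ) (x : UnitAddTorus (Fin 3)) (a b : Fin 3) : I.tensor k x a b = I.tensor k x b a := by
  rw [h.tensor_eq_dTensor_potential]; exact dTensor_symm _ x a b

/-- **The amplitudes `a_{j,k+1}` in the currency** ((abounds), all orders, uniform in the level):
`HasLiftDerivBounds n a_{j,k+1} (N_{k+1} √D_k (2π²c₀A₀)^{-1/2} C_Γ(j,n)) (2Λf_n(k))`.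
[cite: CoiculescuPalasek2025, Prop. 3.13 (abounds)] -/
theorem hasLiftDerivBounds_amp_succ (n k : ℕ) (j : Fin 6) :
    HasLiftDerivBounds n (I.amp (k + 1) j)
      (I.N (k + 1) * (Real.sqrt (I.cst.Dseq k) * Real.sqrt (2 * Real.pi ^ 2 * nashRadius * I.cst.A₀)⁻¹) * nashFieldConst j n)
      (2 * I.Λf n k) :=
  hasLiftDerivBounds_ampCoeff j (h.Dseq_pos k) (h.norm_tensor_le k) (h.hasLiftDerivBounds_tensor n k)
    (h.cutoff' n k) (h.Λf_nonneg n k) h.A₀_pos (h.average (k + 1) j)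

/-- **The pipe potentials in the currency** (Lemma 3.2 (1)): `HasLiftDerivBounds n Ψ⁰_{j,k} (3G_n N_k⁻²) (20N_k)`.
[cite: CoiculescuPalasek2025, Lemma 3.2 (1)] -/
theorem hasLiftDerivBounds_pipe (n k : ℕ) (j : Fin 6) :
    HasLiftDerivBounds n (I.pipe k j) (3 * I.cst.G n * ((I.N k : ℝ) ^ 2)⁻¹) (20 * I.N k) :=
  hasLiftDerivBounds_pipePotential j (h.profile n j) (h.phase k j) (h.M_le_N k)

end Admissible

end IterData

end CP25

end Literature.Analysis.FluidPDE
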